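import Literature.NumberTheory.LFunctions.AriasDeReynaKernel
import Literature.Analysis.Complex.HalfPlaneCauchyLine
import Mathlib.Analysis.Analytic.IsolatedZeros
import HarnessLib

/-!
# The Taylor remainder of `(1−ζ)^{−σ}e^{−λf(ζ)}` as a Cauchy integral over Arias de Reyna's line `L`

Topic `Literature/NumberTheory/LFunctions` (namespace `Literature.NumberTheory.LFunctions.AriasDeReyna`).
Second file of the proof of Arias de Reyna's bounds (Math. Comp. 80 (2011), Thms. 4.1–4.2). In the proof
of Thm. 4.2 the remainder `Rg_K(τ, z)` of the Taylor expansion `g(τ,z) = Σ_k P_k(z) τ^k` is written, after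
the substitution `τ ↦ iζ/(2z)`, as a Cauchy integral over "the line `L` through `1/2` with direction
`e^{πi/4}`", which for every point `z` of the saddle-point line separates the points `0` and `−2izτ` from
the cut `[1, ∞)` of `G_{σ,λ}(ζ) = (1−ζ)^{−σ}e^{−λ f(ζ)}` (`AriasDeReynaKernel.lean`). This file proves that
representation from the half-plane Cauchy formula of the tree
(`Literature.Analysis.Complex.integral_div_sub_eq_of_upperHalfPlane`):

* `lineL y = 1/2 + (1+i)y/2` (complex `y`; real `y` parametrises `L`, `Im y > 0` is the side of `0`),
  with `yCoord` the inverse chart, `norm_lineL_sub_ge` (`|ζ − w| ≥ 1/(2√2)` for `w` on the diagonal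
  through `0`) and `norm_one_sub_lineL_ge` (`|1 − ζ| ≥ 1/(2√2)` on `L`);
* `iterate_dslope_eq` — the iterated difference quotient `(G − T_K)/ζ^{K+1}` of a function with a power
  series at `0` (`T_K` the Taylor polynomial), via Mathlib's `HasFPowerSeriesAt.has_fpower_series_iterate_dslope_fslope`;
* `norm_fKer_le_of_two_le_norm`, `norm_gKer_le_far` — crude growth of `f` and `G` far out
  (`|f| ≤ 3`, `|G| ≤ (1+|ζ|)^{max(−σ,0)} e^{3λ}` for `|ζ| ≥ 2`), only used for the decay hypotheses;
* **`gKer_eq_taylor_add_lineIntegral`** — for `λ ≥ 0`, `K + σ ≥ 0` and `w` with `Re w − Im w < 1/2`: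
  `G(w) = Σ_{k≤K} q_k w^k + w^{K+1} (2πi)^{−1} ∫_L G(ζ) dζ/(ζ^{K+1}(ζ − w))` (eq. before (4.9) of the
  source, our `lineRem`), the pieces `∫_L ζ^{k−K−1} dζ/(ζ−w)` vanishing by Cauchy's theorem on the far
  side of `L`;
* `norm_lineRem_le` — `|(2πi)^{−1}∫_L …| ≤ (1/π) ∫_ℝ |1 − ζ(y)|^{−σ} e^{−λV(ζ(y))} |ζ(y)|^{−K−1} dy` for
  `w` on the diagonal through `0` (the first two lines of (4.9)).

Everything here is proved; no named facts.

## References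

* J. Arias de Reyna, *High precision computation of Riemann's zeta function by the Riemann–Siegel
  formula, I*, Math. Comp. 80 (2011), 995–1009: proof of Thm. 4.2, pp. 1001–1002 (the line `L`,
  `|ζ + 2i√π(v−ip)τ| ≥ 1/(2√2)`, eq. (4.9)). [AriasDeReyna2011]
-/

noncomputable section

open Complex MeasureTheory Set Filter Metric intervalIntegral
open scoped Real Topology NNReal

namespace Literature.NumberTheory.LFunctions

namespace AriasDeReyna

/-! ## The line `L` -/

/-- The line `L` of the source — through `1/2` with direction `e^{πi/4}` — as an affine chart
`ζ(y) = 1/2 + (1+i)y/2` of `ℂ` (`y ∈ ℝ` is the line itself; `Im y > 0` is the half-plane containing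
`0`, `Im y < 0` the one containing the cut `[1, ∞)`). [cite: AriasDeReyna2011, proof of Thm. 4.2 ("the line `L` through `1/2` with direction `e^{πi/4}`")] -/
def lineL (y : ℂ) : ℂ := 1 / 2 + (1 + I) * y / 2

/-- The inverse chart: `y(w) = (w − 1/2)(1 − i)`, so that `lineL (yCoord w) = w`.
[cite: AriasDeReyna2011, proof of Thm. 4.2] -/
def yCoord (w : ℂ) : ℂ := (w - 1 / 2) * (1 - I)

/-- `ζ(y(w)) = w`. [cite: AriasDeReyna2011, proof of Thm. 4.2] -/
lemma lineL_yCoord (w : ℂ) : lineL (yCoord w) = w := by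
  simp only [lineL, yCoord]
  ring_nf
  rw [Complex.I_sq]
  ring

/-- `ζ(y) − w = ((1+i)/2)(y − y(w))`. [cite: AriasDeReyna2011, proof of Thm. 4.2] -/
lemma lineL_sub (y w : ℂ) : lineL y - w = (1 + I) / 2 * (y - yCoord w) := by
  simp only [lineL, yCoord]
  ring_nf
  rw [Complex.I_sq]
  ring

/-- `Im y(w) = Im w − Re w + 1/2`: the side `{Im y > 0}` of `L` is `{Re w − Im w < 1/2}` (it contains
`0` and the whole diagonal through `0`). [cite: AriasDeReyna2011, proof of Thm. 4.2] -/
lemma yCoord_im (w : ℂ) : (yCoord w).im = w.im - w.re + 1 / 2 := by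
  simp [yCoord]; ring

/-- Real and imaginary parts of `ζ(y)`. [cite: AriasDeReyna2011, proof of Thm. 4.2 ("`ζ = 1/2 + (y/2)(1+i)`")] -/
lemma lineL_re (y : ℂ) : (lineL y).re = (1 + y.re - y.im) / 2 := by
  simp [lineL]; ring

/-- Real and imaginary parts of `ζ(y)`. [cite: AriasDeReyna2011, proof of Thm. 4.2] -/
lemma lineL_im (y : ℂ) : (lineL y).im = (y.re + y.im) / 2 := by
  simp [lineL]; ring

/-- `|ζ(y)|² = ((1+y)² + y²)/4` on the line. [cite: AriasDeReyna2011, proof of Thm. 4.2] -/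
lemma normSq_lineL_ofReal (y : ℝ) : ‖lineL y‖ ^ 2 = ((1 + y) ^ 2 + y ^ 2) / 4 := by
  rw [Complex.sq_norm, Complex.normSq_apply, lineL_re, lineL_im]
  simp; ring

/-- `|1 − ζ(y)|² = ((1−y)² + y²)/4` on the line. [cite: AriasDeReyna2011, proof of Thm. 4.2] -/
lemma normSq_one_sub_lineL_ofReal (y : ℝ) : ‖1 - lineL y‖ ^ 2 = ((1 - y) ^ 2 + y ^ 2) / 4 := by
  rw [Complex.sq_norm, Complex.normSq_apply]
  have h1 : (1 - lineL y).re = (1 - y) / 2 := by rw [sub_re, lineL_re]; simp; ring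
  have h2 : (1 - lineL y).im = -y / 2 := by rw [sub_im, lineL_im]; simp; ring
  rw [h1, h2]; ring

/-- Points of the closed half-plane `{Im y > −1/2}` map off the cut `[1, ∞)`; in particular the line
`L` and the side of `0` lie in the domain of holomorphy of `G`. [cite: AriasDeReyna2011, proof of Thm. 4.2] -/
lemma lineL_mem_cutPlane {y : ℂ} (hy : -1 / 2 < y.im) : lineL y ∈ cutPlane := by
  by_contra h
  simp only [cutPlane, Set.mem_setOf_eq, not_or, not_not, not_lt] at h
  rw [lineL_im] at h
  have h2 := h.2
  rw [lineL_re] at h2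
  have : y.re = -y.im := by linarith [h.1]
  rw [this] at h2
  linarith

/-- The side of `0`: `Re w − Im w < 1/2` implies `w` is off the cut. [cite: AriasDeReyna2011, proof of Thm. 4.2] -/
lemma mem_cutPlane_of_re_sub_im_lt {w : ℂ} (hw : w.re - w.im < 1 / 2) : w ∈ cutPlane := by
  have := lineL_mem_cutPlane (y := yCoord w) (by rw [yCoord_im]; linarith)
  rwa [lineL_yCoord] at this

/-- `|ζ(y)| ≥ 1/(2√2)` on `L`, in the form `1/8 ≤ |ζ(y)|²`. [cite: AriasDeReyna2011, proof of Thm. 4.2] -/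
lemma normSq_lineL_ge (y : ℝ) : 1 / 8 ≤ ‖lineL y‖ ^ 2 := by
  rw [normSq_lineL_ofReal]; nlinarith [sq_nonneg (y + 1 / 2)]

/-- `ζ(y) ≠ 0` on `L`. [cite: AriasDeReyna2011, proof of Thm. 4.2] -/
lemma lineL_ofReal_ne_zero (y : ℝ) : lineL y ≠ 0 := by
  intro h
  have := normSq_lineL_ge y
  rw [h, norm_zero] at this
  norm_num at this

/-- `|1 − ζ| ≥ 1/(2√2)` on `L`, in the form `1/8 ≤ |1 − ζ(y)|²`.
[cite: AriasDeReyna2011, proof of Thm. 4.2 ("`|1 − ζ| ≥ 1/(2√2)`")] -/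
lemma normSq_one_sub_lineL_ge (y : ℝ) : 1 / 8 ≤ ‖1 - lineL y‖ ^ 2 := by
  rw [normSq_one_sub_lineL_ofReal]; nlinarith [sq_nonneg (y - 1 / 2)]

/-- **`|ζ − w| ≥ 1/(2√2)`** for `ζ ∈ L` and `w` on the parallel line through `0` (the diagonal
`Re w = Im w`), in the form `1/8 ≤ |ζ(y) − w|²`. [cite: AriasDeReyna2011, proof of Thm. 4.2 ("`|ζ + 2i√π(v − ip)τ| ≥ ½√2`")] -/
lemma normSq_lineL_sub_ge (y : ℝ) {w : ℂ} (hw : w.re = w.im) : 1 / 8 ≤ ‖lineL y - w‖ ^ 2 := by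
  rw [Complex.sq_norm, Complex.normSq_apply, sub_re, sub_im, lineL_re, lineL_im]
  simp only [ofReal_re, ofReal_im, sub_zero, add_zero]
  nlinarith [sq_nonneg ((1 + y) / 2 - w.re + (y / 2 - w.im))]

/-- `ζ(y) ≠ w` on `L` for `w` on the diagonal through `0`. [cite: AriasDeReyna2011, proof of Thm. 4.2] -/
lemma lineL_ofReal_ne_of_diag (y : ℝ) {w : ℂ} (hw : w.re = w.im) : lineL y - w ≠ 0 := by
  intro h
  have := normSq_lineL_sub_ge y hw
  rw [h, norm_zero] at this
  norm_num at this

/-- `ζ(y) ≠ w` on `L` for `w` strictly on the side of `0`. [cite: AriasDeReyna2011, proof of Thm. 4.2] -/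
lemma lineL_ofReal_ne {w : ℂ} (hw : w.re - w.im < 1 / 2) (y : ℝ) : lineL y - w ≠ 0 := by
  rw [lineL_sub]
  refine mul_ne_zero (by norm_num [Complex.ext_iff]) (sub_ne_zero.2 fun h ↦ ?_)
  have := congrArg Complex.im h
  rw [yCoord_im] at this
  simp at this
  linarith

/-- The chart `ζ(y)` is continuous. [cite: AriasDeReyna2011, proof of Thm. 4.2] -/
lemma continuous_lineL : Continuous lineL := by unfold lineL; fun_prop

/-- The chart `ζ(y)` is holomorphic (affine). [cite: AriasDeReyna2011, proof of Thm. 4.2] -/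
lemma differentiable_lineL : Differentiable ℂ lineL := by unfold lineL; fun_prop

/-- `|(1+i)/2| ≤ 1`. [folklore] -/
private lemma norm_c_le : ‖(1 + I) / 2‖ ≤ (1:ℝ) := by
  rw [norm_div]
  have : ‖(1:ℂ) + I‖ ^ 2 = 2 := by rw [Complex.sq_norm, Complex.normSq_apply]; simp; norm_num
  have h2 : ‖(1:ℂ) + I‖ ≤ 2 := by nlinarith [norm_nonneg ((1:ℂ) + I)]
  simp; linarith

/-- `|(1+i)/2| = √2/2 ≤ 1` and `|(1+i)/2|² = 1/2`. [folklore] -/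
private lemma normSq_c : ‖(1 + I) / 2‖ ^ 2 = 1 / 2 := by
  rw [norm_div, div_pow, Complex.sq_norm, Complex.normSq_apply]; simp; norm_num

/-- `(1+i)/2 ≠ 0`. [folklore] -/
private lemma c_ne_zero : (1 + I) / 2 ≠ (0:ℂ) := by norm_num [Complex.ext_iff]

/-- Far out on the chart: `|ζ(y)| ≥ |y|/4` once `|y| ≥ 8`. [cite: AriasDeReyna2011, proof of Thm. 4.2] -/
lemma norm_lineL_ge {y : ℂ} (hy : 8 ≤ ‖y‖) : ‖y‖ / 4 ≤ ‖lineL y‖ := by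
  have h1 : ‖(1 + I) * y / 2‖ = ‖y‖ * (‖(1:ℂ) + I‖ / 2) := by
    rw [norm_div, norm_mul]; simp; ring
  have h2 : 1 ≤ ‖(1:ℂ) + I‖ := by
    have : ‖(1:ℂ) + I‖ ^ 2 = 2 := by rw [Complex.sq_norm, Complex.normSq_apply]; simp; norm_num
    nlinarith [norm_nonneg ((1:ℂ) + I)]
  have h3 : ‖y‖ / 2 ≤ ‖(1 + I) * y / 2‖ := by rw [h1]; nlinarith [norm_nonneg y]
  have h4 := norm_sub_norm_le ((1 + I) * y / 2) (-(1/2:ℂ))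
  have h5 : (1 + I) * y / 2 - -(1/2:ℂ) = lineL y := by rw [lineL]; ring
  rw [h5] at h4
  have : ‖(-(1/2:ℂ))‖ = 1 / 2 := by simp
  rw [this] at h4
  linarith

/-- Far out on the chart: `|ζ(y) − w| ≥ |y|/8` once `|y| ≥ 8|w| + 8`. [cite: AriasDeReyna2011, proof of Thm. 4.2] -/
lemma norm_lineL_sub_ge {y w : ℂ} (hy : 8 * ‖w‖ + 8 ≤ ‖y‖) : ‖y‖ / 8 ≤ ‖lineL y - w‖ := by
  have hw0 := norm_nonneg w
  have hL := norm_lineL_ge (y := y) (by linarith)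
  have := norm_sub_norm_le (lineL y) w
  linarith

/-! ## Growth of `f` and `G` far out (for the decay hypotheses only) -/

/-- `|f(ζ)| ≤ 3` for `|ζ| ≥ 2` off the cut. [cite: AriasDeReyna2011, eq. (4.5)] -/
lemma norm_fKer_le_of_two_le_norm {ζ : ℂ} (hζ : ζ ∈ cutPlane) (h2 : 2 ≤ ‖ζ‖) : ‖fKer ζ‖ ≤ 3 := by
  have hζ0 : ζ ≠ 0 := by intro h; rw [h, norm_zero] at h2; norm_num at h2
  have hpos : 0 < ‖ζ‖ := by linarith
  rw [fKer_eq_log hζ hζ0]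
  -- `‖log(1 − ζ)‖ ≤ ‖ζ‖ + π`
  have h1 : 1 ≤ ‖1 - ζ‖ := by
    have := norm_sub_norm_le ζ 1
    rw [norm_one, norm_sub_rev] at this; linarith
  have h1' : ‖1 - ζ‖ ≤ 1 + ‖ζ‖ := by
    have := norm_sub_le (1:ℂ) ζ; rwa [norm_one] at this
  have hlog : ‖Complex.log (1 - ζ)‖ ≤ ‖ζ‖ + π := by
    have hre : |(Complex.log (1 - ζ)).re| ≤ ‖ζ‖ := by
      rw [Complex.log_re, abs_of_nonneg (Real.log_nonneg h1)]
      have := Real.log_le_sub_one_of_pos (by linarith : (0:ℝ) < ‖1 - ζ‖)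
      linarith
    have him : |(Complex.log (1 - ζ)).im| ≤ π := by
      rw [Complex.log_im]; exact Complex.abs_arg_le_pi _
    calc ‖Complex.log (1 - ζ)‖ ≤ |(Complex.log (1 - ζ)).re| + |(Complex.log (1 - ζ)).im| :=
          Complex.norm_le_abs_re_add_abs_im _
      _ ≤ ‖ζ‖ + π := add_le_add hre him
  have hpi : π ≤ 4 := Real.pi_le_four
  have t1 := norm_sub_le (-Complex.log (1 - ζ) / ζ ^ 2 - 1 / ζ) (1 / 2 : ℂ)
  have t2 := norm_sub_le (-Complex.log (1 - ζ) / ζ ^ 2) (1 / ζ : ℂ)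
  have e1 : ‖-Complex.log (1 - ζ) / ζ ^ 2‖ = ‖Complex.log (1 - ζ)‖ / ‖ζ‖ ^ 2 := by
    rw [norm_div, norm_neg, norm_pow]
  have e2 : ‖(1 / ζ : ℂ)‖ = 1 / ‖ζ‖ := by rw [norm_div, norm_one]
  have e3 : ‖(1 / 2 : ℂ)‖ = 1 / 2 := by norm_num
  have hA : ‖Complex.log (1 - ζ)‖ / ‖ζ‖ ^ 2 ≤ 2 := by
    rw [div_le_iff₀ (by positivity)]; nlinarith
  have hB : 1 / ‖ζ‖ ≤ 1 / 2 := by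
    rw [div_le_div_iff₀ hpos two_pos]; linarith
  linarith [e1.le, e1.ge]

/-- `|G_{σ,λ}(ζ)| ≤ (1 + |ζ|)^{max(−σ,0)} e^{3λ}` for `|ζ| ≥ 2` off the cut and `λ ≥ 0`.
[cite: AriasDeReyna2011, proof of Thm. 4.2 (convergence of the integral over `L`)] -/
lemma norm_gKer_le_far {σ lam : ℝ} {ζ : ℂ} (hζ : ζ ∈ cutPlane) (h2 : 2 ≤ ‖ζ‖) (hlam : 0 ≤ lam) :
    ‖gKer σ lam ζ‖ ≤ (1 + ‖ζ‖) ^ (max (-σ) 0) * Real.exp (3 * lam) := by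
  rw [norm_gKer hζ]
  have h1 : 1 ≤ ‖1 - ζ‖ := by
    have := norm_sub_norm_le ζ 1
    rw [norm_one, norm_sub_rev] at this; linarith
  have h1' : ‖1 - ζ‖ ≤ 1 + ‖ζ‖ := by
    have := norm_sub_le (1:ℂ) ζ; rwa [norm_one] at this
  refine mul_le_mul ?_ ?_ (Real.exp_pos _).le (Real.rpow_nonneg (by positivity) _)
  · rcases le_or_gt 0 σ with hσ | hσ
    · calc ‖1 - ζ‖ ^ (-σ) ≤ 1 := Real.rpow_le_one_of_one_le_of_nonpos h1 (by linarith)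
        _ ≤ (1 + ‖ζ‖) ^ (max (-σ) 0) := Real.one_le_rpow (by linarith [norm_nonneg ζ]) (le_max_right _ _)
    · rw [max_eq_left (by linarith)]
      exact Real.rpow_le_rpow (by linarith) h1' (by linarith)
  · rw [Real.exp_le_exp]
    have hf := norm_fKer_le_of_two_le_norm hζ h2
    have : -(fKer ζ).re ≤ ‖fKer ζ‖ := by
      have := Complex.abs_re_le_norm (fKer ζ); linarith [neg_abs_le (fKer ζ).re]
    nlinarith

/-! ## The iterated difference quotient `(G − T_K)/ζ^{K+1}` -/

/-- For a function with a power series `p` at `0`, the `n`-fold `dslope` at `0` is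
`(f(z) − Σ_{k<n} p_k z^k)/z^n` off `0`. [folklore] -/
private lemma iterate_dslope_eq {f : ℂ → ℂ} {p : FormalMultilinearSeries ℂ ℂ ℂ} (hp : HasFPowerSeriesAt f p 0) :
    ∀ n : ℕ, ∀ z : ℂ, z ≠ 0 →
      (Function.swap dslope (0:ℂ))^[n] f z = (f z - ∑ k ∈ Finset.range n, p.coeff k * z ^ k) / z ^ n
  | 0, z, _ => by simp
  | n + 1, z, hz => by
      have hval : (Function.swap dslope (0:ℂ))^[n] f 0 = p.coeff n := by
        have h := (hp.has_fpower_series_iterate_dslope_fslope n).coeff_zero 1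
        rw [← h]
        change (FormalMultilinearSeries.fslope^[n] p).coeff 0 = p.coeff n
        rw [FormalMultilinearSeries.coeff_iterate_fslope, zero_add]
      rw [Function.iterate_succ_apply']
      change dslope ((Function.swap dslope (0:ℂ))^[n] f) 0 z = _
      rw [dslope_of_ne _ hz, slope, vsub_eq_sub, iterate_dslope_eq hp n z hz, hval, sub_zero, smul_eq_mul,
        Finset.sum_range_succ]
      have hzn : z ^ n ≠ 0 := pow_ne_zero _ hz
      field_simp
      ring

/-- Iterated `dslope` at an interior point preserves holomorphy on an open set. [folklore] -/
private lemma differentiableOn_iterate_dslope {f : ℂ → ℂ} {U : Set ℂ} (hU : U ∈ 𝓝 (0:ℂ))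
    (hf : DifferentiableOn ℂ f U) (n : ℕ) :
    DifferentiableOn ℂ ((Function.swap dslope (0:ℂ))^[n] f) U := by
  induction n with
  | zero => simpa using hf
  | succ n ih =>
      rw [Function.iterate_succ']
      exact (Complex.differentiableOn_dslope hU).2 ih

/-! ## The Taylor formula with the remainder over `L` -/

/-- The remainder factor: `(2πi)^{−1} ∫_L G(ζ) dζ/(ζ^{K+1}(ζ − w))`, written as an integral over the
real parameter `y` of `L` (`dζ = ((1+i)/2) dy`). [cite: AriasDeReyna2011, proof of Thm. 4.2 (the formula for `Rg_K` over `L`)] -/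
def lineRem (σ lam : ℝ) (K : ℕ) (w : ℂ) : ℂ :=
  (2 * π * I)⁻¹ * ∫ y : ℝ, gKer σ lam (lineL y) / ((lineL y) ^ (K + 1) * (lineL y - w)) * ((1 + I) / 2)

/-- `q₀ = G(0) = 1`. [cite: AriasDeReyna2011, §5 ("`P₀(x) = 1`")] -/
lemma qCoeff_zero (σ lam : ℝ) : qCoeff σ lam 0 = 1 := by
  have hp := (hasFPowerSeriesOnBall_gKer σ lam (by norm_num : (0:ℝ) < 1 / 2) (by norm_num)).hasFPowerSeriesAt
  have h := hp.coeff_zero 1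
  rw [gKer_zero] at h
  rw [qCoeff, ← h]
  rfl

/-- Integrability on `L` of `ζ ↦ ζ^{−m}(ζ − w)^{−1}` for `m ≥ 1` and its vanishing integral (Cauchy's
theorem on the side of the cut, where this function is holomorphic and `O(|ζ|^{−2})`): the Taylor
polynomial contributes nothing to the integral over `L`. [cite: AriasDeReyna2011, proof of Thm. 4.2] -/
lemma integral_lineL_pow_inv_div_sub_eq_zero {w : ℂ} (hw : w.re - w.im < 1 / 2) {m : ℕ} (hm : 1 ≤ m) :
    Integrable (fun y : ℝ ↦ ((lineL y) ^ m * (lineL y - w))⁻¹ * ((1 + I) / 2)) ∧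
    ∫ y : ℝ, ((lineL y) ^ m * (lineL y - w))⁻¹ * ((1 + I) / 2) = 0 := by
  -- the holomorphic function on `{Im y < min (1/2) (Im y_w)}`
  set h : ℂ → ℂ := fun y ↦ ((lineL y) ^ m * (lineL y - w))⁻¹ * ((1 + I) / 2) with hh
  have hyw : 0 < (yCoord w).im := by rw [yCoord_im]; linarith
  have hne : ∀ y : ℂ, y.im ≤ 0 → (lineL y) ^ m * (lineL y - w) ≠ 0 := by
    intro y hy
    refine mul_ne_zero (pow_ne_zero _ fun h0 ↦ ?_) fun h0 ↦ ?_
    · have := congrArg Complex.im (show lineL y = lineL (yCoord 0) by rw [lineL_yCoord, h0])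
      rw [lineL_im, lineL_im, yCoord_im] at this
      have h2 := congrArg Complex.re (show lineL y = lineL (yCoord 0) by rw [lineL_yCoord, h0])
      rw [lineL_re, lineL_re] at h2
      simp [yCoord] at this h2
      linarith
    · rw [lineL_sub] at h0
      have h1 : y - yCoord w = 0 := by
        rcases mul_eq_zero.1 h0 with h | h
        · norm_num [Complex.ext_iff] at h
        · exact h
      have := congrArg Complex.im (sub_eq_zero.1 h1)
      linarith
  have hdiff : DifferentiableOn ℂ h {y : ℂ | y.im < 0} := by
    refine DifferentiableOn.mul (DifferentiableOn.inv ?_ fun y hy ↦ hne y (le_of_lt hy)) (differentiableOn_const _)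
    exact ((differentiable_lineL.pow _).mul (differentiable_lineL.sub_const _)).differentiableOn
  have hcont : ContinuousOn h {y : ℂ | y.im ≤ 0} := by
    refine ContinuousOn.mul (ContinuousOn.inv₀ ?_ fun y hy ↦ hne y hy) continuousOn_const
    exact ((continuous_lineL.pow _).mul (continuous_lineL.sub continuous_const)).continuousOn
  -- decay `‖h y‖ ≤ 32/‖y‖²` for `‖y‖ ≥ 8‖w‖ + 8`
  have hdecay : ∀ y : ℂ, 8 * ‖w‖ + 8 ≤ ‖y‖ → ‖h y‖ ≤ 32 / ‖y‖ ^ 2 := by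
    intro y hy
    have hw0 := norm_nonneg w
    have hy1 : 8 ≤ ‖y‖ := by linarith
    have hL := norm_lineL_ge hy1
    have hLw := norm_lineL_sub_ge hy
    have hLm : ‖y‖ / 4 ≤ ‖lineL y‖ ^ m := by
      calc ‖y‖ / 4 ≤ ‖lineL y‖ := hL
        _ = ‖lineL y‖ ^ 1 := (pow_one _).symm
        _ ≤ ‖lineL y‖ ^ m := pow_le_pow_right₀ (by linarith) hm
    rw [hh]
    simp only
    rw [norm_mul, norm_inv, norm_mul, norm_pow]
    have hprod : ‖y‖ / 4 * (‖y‖ / 8) ≤ ‖lineL y‖ ^ m * ‖lineL y - w‖ :=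
      mul_le_mul hLm hLw (by positivity) (by positivity)
    have hypos : 0 < ‖y‖ := by linarith
    calc (‖lineL y‖ ^ m * ‖lineL y - w‖)⁻¹ * ‖(1 + I) / 2‖ ≤ (‖y‖ / 4 * (‖y‖ / 8))⁻¹ * 1 := by
          refine mul_le_mul ((inv_le_inv₀ (lt_of_lt_of_le (by positivity) hprod) (by positivity)).2 hprod)
            norm_c_le (norm_nonneg _) (by positivity)
      _ = 32 / ‖y‖ ^ 2 := by field_simp; ring
  have hint : Integrable (fun y : ℝ ↦ h y) := by
    refine Literature.Analysis.Complex.integrable_of_continuous_of_decay_sq (C := 32) (R := 8 * ‖w‖ + 8)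
      (hcont.comp_continuous continuous_ofReal fun y ↦ by simp) fun y hy ↦ ?_
    have h1 := hdecay y (by simpa using hy)
    have h2 : ‖(y : ℂ)‖ ^ 2 = y ^ 2 := by rw [Complex.norm_real, Real.norm_eq_abs, sq_abs]
    rwa [h2] at h1
  exact ⟨hint, Literature.Analysis.Complex.integral_eq_zero_of_lowerHalfPlane (C := 32) (R₀ := 8 * ‖w‖ + 8)
      hcont hdiff fun y _ hy ↦ hdecay y hy⟩


/-- The vanishing pieces in the form `∫_L ζ^k dζ/(ζ^{K+1}(ζ − w)) = 0` for `k ≤ K`.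
[cite: AriasDeReyna2011, proof of Thm. 4.2] -/
lemma integral_lineL_pow_div_eq_zero {w : ℂ} (hw : w.re - w.im < 1 / 2) {K k : ℕ} (hk : k ≤ K) :
    Integrable (fun y : ℝ ↦ (lineL y) ^ k / ((lineL y) ^ (K + 1) * (lineL y - w)) * ((1 + I) / 2)) ∧
    ∫ y : ℝ, (lineL y) ^ k / ((lineL y) ^ (K + 1) * (lineL y - w)) * ((1 + I) / 2) = 0 := by
  obtain ⟨hi, hv⟩ := integral_lineL_pow_inv_div_sub_eq_zero hw (m := K + 1 - k) (by omega)
  have heq : (fun y : ℝ ↦ (lineL y) ^ k / ((lineL y) ^ (K + 1) * (lineL y - w)) * ((1 + I) / 2)) =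
      fun y : ℝ ↦ ((lineL y) ^ (K + 1 - k) * (lineL y - w))⁻¹ * ((1 + I) / 2) := by
    funext y
    have hz := lineL_ofReal_ne_zero y
    have hzk : (lineL y) ^ k ≠ 0 := pow_ne_zero _ hz
    have hsplit : (lineL y) ^ (K + 1) = (lineL y) ^ k * (lineL y) ^ (K + 1 - k) := by
      rw [← pow_add]; congr 1; omega
    have hzw := lineL_ofReal_ne hw y
    have hzK : (lineL y) ^ (K + 1 - k) ≠ 0 := pow_ne_zero _ hz
    rw [hsplit]
    field_simp
  rw [heq]
  exact ⟨hi, hv⟩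

/-- Integrability of the remainder integrand `G(ζ)/(ζ^{K+1}(ζ − w))` along `L` (decay `O(|ζ|^{−σ⁻−K−2})`,
`σ⁻ = max(−σ, 0) ≤ K − 1`). [cite: AriasDeReyna2011, proof of Thm. 4.2 ("the integral in (4.9) converges for `K + σ > 0`")] -/
lemma integrable_gKer_lineL_div {σ lam : ℝ} (hlam : 0 ≤ lam) {K : ℕ} (hK1 : 1 ≤ K) (hKσ : 1 ≤ (K : ℝ) + σ)
    {w : ℂ} (hw : w.re - w.im < 1 / 2) :
    Integrable (fun y : ℝ ↦ gKer σ lam (lineL y) / ((lineL y) ^ (K + 1) * (lineL y - w)) * ((1 + I) / 2)) := by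
  have hcont : Continuous fun y : ℝ ↦ gKer σ lam (lineL y) / ((lineL y) ^ (K + 1) * (lineL y - w)) * ((1 + I) / 2) := by
    have hl : Continuous fun y : ℝ ↦ lineL y := continuous_lineL.comp continuous_ofReal
    refine (Continuous.div ?_ ((hl.pow _).mul (hl.sub continuous_const))
      fun y ↦ mul_ne_zero (pow_ne_zero _ (lineL_ofReal_ne_zero y)) (lineL_ofReal_ne hw y)).mul continuous_const
    exact (continuousOn_gKer σ lam).comp_continuous hl
      fun y ↦ lineL_mem_cutPlane (by simp only [Complex.ofReal_im]; norm_num)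
  refine Literature.Analysis.Complex.integrable_of_continuous_of_decay_sq
    (C := 64 * (2 ^ K * Real.exp (3 * lam))) (R := 8 * ‖w‖ + 8) hcont fun y hy ↦ ?_
  have hw0 := norm_nonneg w
  have hyc : ‖(y : ℂ)‖ = |y| := by simp
  have hy8 : 8 ≤ ‖(y : ℂ)‖ := by rw [hyc]; linarith
  have hL := norm_lineL_ge hy8
  have hLw := norm_lineL_sub_ge (y := (y : ℂ)) (w := w) (by rw [hyc]; exact hy)
  rw [hyc] at hL hLw
  have hζ2 : 2 ≤ ‖lineL y‖ := by linarith
  have hζ1 : 1 ≤ ‖lineL y‖ := by linarith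
  have hζD : lineL (y : ℂ) ∈ cutPlane := lineL_mem_cutPlane (by simp only [Complex.ofReal_im]; norm_num)
  have hG := norm_gKer_le_far (σ := σ) hζD hζ2 hlam
  -- `(1 + |ζ|)^{σ⁻} ≤ (2|ζ|)^{K-1}`
  have hs : (1 + ‖lineL y‖) ^ (max (-σ) 0) ≤ (2 * ‖lineL y‖) ^ (K - 1) := by
    have h1 : (1:ℝ) ≤ 1 + ‖lineL y‖ := by linarith [norm_nonneg (lineL (y:ℂ))]
    have hK' : max (-σ) 0 ≤ ((K - 1 : ℕ) : ℝ) := by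
      have hK1' : (1:ℝ) ≤ K := by exact_mod_cast hK1
      rw [Nat.cast_sub hK1, Nat.cast_one]
      exact max_le (by linarith) (by linarith)
    calc (1 + ‖lineL y‖) ^ (max (-σ) 0) ≤ (1 + ‖lineL y‖) ^ (((K - 1 : ℕ) : ℝ)) :=
          Real.rpow_le_rpow_of_exponent_le h1 hK'
      _ = (1 + ‖lineL y‖) ^ (K - 1) := Real.rpow_natCast _ _
      _ ≤ (2 * ‖lineL y‖) ^ (K - 1) := pow_le_pow_left₀ (by positivity) (by linarith) _
  rw [norm_mul, norm_div, norm_mul, norm_pow]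
  have hypos : 0 < |y| := by linarith
  have hy1 : 1 ≤ |y| := by linarith
  have hζpos : 0 < ‖lineL (y:ℂ)‖ := by linarith
  have hLwpos : 0 < ‖lineL ↑y - w‖ := by linarith
  -- step 1: numerator and denominator
  have hnum : ‖gKer σ lam (lineL ↑y)‖ ≤ 2 ^ (K - 1) * ‖lineL ↑y‖ ^ (K - 1) * Real.exp (3 * lam) := by
    have := hG.trans (mul_le_mul_of_nonneg_right hs (Real.exp_pos _).le)
    rwa [mul_pow] at this
  have hden : ‖lineL ↑y‖ ^ (K - 1) * (‖lineL ↑y‖ ^ 2 * (|y| / 8)) ≤ ‖lineL ↑y‖ ^ (K + 1) * ‖lineL ↑y - w‖ := by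
    have hK : K + 1 = (K - 1) + 2 := by omega
    rw [hK, pow_add, mul_assoc]
    exact mul_le_mul_of_nonneg_left (mul_le_mul_of_nonneg_left hLw (by positivity)) (by positivity)
  have hq : ‖gKer σ lam (lineL ↑y)‖ / (‖lineL ↑y‖ ^ (K + 1) * ‖lineL ↑y - w‖) ≤
      (2 ^ (K - 1) * Real.exp (3 * lam)) / (‖lineL ↑y‖ ^ 2 * (|y| / 8)) := by
    calc ‖gKer σ lam (lineL ↑y)‖ / (‖lineL ↑y‖ ^ (K + 1) * ‖lineL ↑y - w‖)
        ≤ (2 ^ (K - 1) * ‖lineL ↑y‖ ^ (K - 1) * Real.exp (3 * lam)) /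
            (‖lineL ↑y‖ ^ (K - 1) * (‖lineL ↑y‖ ^ 2 * (|y| / 8))) :=
          div_le_div₀ (by positivity) hnum (by positivity) hden
      _ = (2 ^ (K - 1) * Real.exp (3 * lam)) / (‖lineL ↑y‖ ^ 2 * (|y| / 8)) := by
          have hzK : ‖lineL (y:ℂ)‖ ^ (K - 1) ≠ 0 := pow_ne_zero _ hζpos.ne'
          field_simp
  -- step 2: `‖ζ‖² ≥ y²/16`
  have hζsq : (|y| / 4) ^ 2 ≤ ‖lineL ↑y‖ ^ 2 := pow_le_pow_left₀ (by positivity) hL 2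
  calc ‖gKer σ lam (lineL ↑y)‖ / (‖lineL ↑y‖ ^ (K + 1) * ‖lineL ↑y - w‖) * ‖(1 + I) / 2‖
      ≤ (2 ^ (K - 1) * Real.exp (3 * lam)) / (‖lineL ↑y‖ ^ 2 * (|y| / 8)) * 1 :=
        mul_le_mul hq norm_c_le (norm_nonneg _) (by positivity)
    _ ≤ (2 ^ (K - 1) * Real.exp (3 * lam)) / ((|y| / 4) ^ 2 * (|y| / 8)) * 1 := by
        refine mul_le_mul_of_nonneg_right (div_le_div_of_nonneg_left (by positivity) (by positivity)
          (mul_le_mul_of_nonneg_right hζsq (by positivity))) zero_le_one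
    _ = 32 * (2 ^ K * Real.exp (3 * lam)) / y ^ 2 * (2 / |y|) := by
        have hK2 : (2:ℝ) ^ K = 2 ^ (K - 1) * 2 := by rw [← pow_succ]; congr 1; omega
        rw [hK2, ← sq_abs y]
        field_simp
        ring
    _ ≤ 32 * (2 ^ K * Real.exp (3 * lam)) / y ^ 2 * 2 := by
        refine mul_le_mul_of_nonneg_left ?_ (by positivity)
        rw [div_le_iff₀ hypos]; linarith
    _ = 64 * (2 ^ K * Real.exp (3 * lam)) / y ^ 2 := by ring

/-- **Taylor's formula for `G_{σ,λ}` with the remainder as a Cauchy integral over `L`.** For `λ ≥ 0`,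
`K ≥ 1` with `K + σ ≥ 1`, and `w` on the side of `L` containing `0` (`Re w − Im w < 1/2`; in the
application `w = −2izτ` lies on the diagonal through `0`):
`G(w) = Σ_{k ≤ K} q_k w^k + w^{K+1} · (2πi)^{−1} ∫_L G(ζ) dζ/(ζ^{K+1}(ζ − w))`.
[cite: AriasDeReyna2011, eq. (3.7) and proof of Thm. 4.2 (the two displayed formulas for `Rg_K`)] -/
theorem gKer_eq_taylor_add_lineRem {σ lam : ℝ} (hlam : 0 ≤ lam) {K : ℕ} (hK1 : 1 ≤ K) (hKσ : 1 ≤ (K : ℝ) + σ)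
    {w : ℂ} (hw : w.re - w.im < 1 / 2) :
    gKer σ lam w = ∑ k ∈ Finset.range (K + 1), qCoeff σ lam k * w ^ k + w ^ (K + 1) * lineRem σ lam K w := by
  by_cases hw0 : w = 0
  · subst hw0
    rw [gKer_zero, Finset.sum_range_succ', qCoeff_zero]
    simp
  -- the power series at `0` and the iterated difference quotient `H`
  set p := cauchyPowerSeries (gKer σ lam) 0 (1 / 2) with hp_def
  have hp : HasFPowerSeriesAt (gKer σ lam) p 0 :=
    (hasFPowerSeriesOnBall_gKer σ lam (by norm_num : (0:ℝ) < 1 / 2) (by norm_num)).hasFPowerSeriesAt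
  have hq : ∀ k, qCoeff σ lam k = p.coeff k := fun k ↦ rfl
  set H : ℂ → ℂ := (Function.swap dslope (0:ℂ))^[K + 1] (gKer σ lam) with hH
  have hHdiff : DifferentiableOn ℂ H cutPlane :=
    differentiableOn_iterate_dslope (isOpen_cutPlane.mem_nhds zero_mem_cutPlane) (differentiableOn_gKer σ lam) _
  have hHeq : ∀ z : ℂ, z ≠ 0 → H z = (gKer σ lam z - ∑ k ∈ Finset.range (K + 1), p.coeff k * z ^ k) / z ^ (K + 1) :=
    iterate_dslope_eq hp (K + 1)
  -- `h = H ∘ ζ` on the closed upper half-plane of the chart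
  set h : ℂ → ℂ := fun y ↦ H (lineL y) with hh
  have hmaps : ∀ y : ℂ, 0 ≤ y.im → lineL y ∈ cutPlane := fun y hy ↦ lineL_mem_cutPlane (by linarith)
  have hc : ContinuousOn h {y : ℂ | 0 ≤ y.im} :=
    hHdiff.continuousOn.comp continuous_lineL.continuousOn fun y hy ↦ hmaps y hy
  have hd : DifferentiableOn ℂ h {y : ℂ | 0 < y.im} :=
    hHdiff.comp differentiable_lineL.differentiableOn fun y hy ↦ hmaps y (le_of_lt hy)
  -- decay of `h`
  set S : ℝ := ∑ k ∈ Finset.range (K + 1), ‖p.coeff k‖ with hS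
  have hS0 : 0 ≤ S := Finset.sum_nonneg fun k _ ↦ norm_nonneg _
  have hdecay : ∀ y : ℂ, 0 ≤ y.im → 8 ≤ ‖y‖ → ‖h y‖ ≤ 4 * (2 ^ K * Real.exp (3 * lam) + S) / ‖y‖ := by
    intro y hy hy8
    have hL := norm_lineL_ge hy8
    have hζ2 : 2 ≤ ‖lineL y‖ := by linarith
    have hζ1 : 1 ≤ ‖lineL y‖ := by linarith
    have hζpos : 0 < ‖lineL y‖ := by linarith
    have hζ0 : lineL y ≠ 0 := norm_pos_iff.1 hζpos
    have hζD := hmaps y hy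
    rw [hh]
    simp only
    rw [hHeq _ hζ0, norm_div, norm_pow]
    have hG := norm_gKer_le_far (σ := σ) hζD hζ2 hlam
    have hs : (1 + ‖lineL y‖) ^ (max (-σ) 0) ≤ (2 * ‖lineL y‖) ^ K := by
      have h1 : (1:ℝ) ≤ 1 + ‖lineL y‖ := by linarith
      have hK' : max (-σ) 0 ≤ (K : ℝ) :=
        max_le (by linarith) (by positivity)
      calc (1 + ‖lineL y‖) ^ (max (-σ) 0) ≤ (1 + ‖lineL y‖) ^ (K : ℝ) :=
            Real.rpow_le_rpow_of_exponent_le h1 hK'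
        _ = (1 + ‖lineL y‖) ^ K := Real.rpow_natCast _ _
        _ ≤ (2 * ‖lineL y‖) ^ K := pow_le_pow_left₀ (by positivity) (by linarith) _
    have hT : ‖∑ k ∈ Finset.range (K + 1), p.coeff k * lineL y ^ k‖ ≤ S * ‖lineL y‖ ^ K := by
      rw [hS, Finset.sum_mul]
      refine (norm_sum_le _ _).trans (Finset.sum_le_sum fun k hk ↦ ?_)
      rw [norm_mul, norm_pow]
      refine mul_le_mul_of_nonneg_left (pow_le_pow_right₀ hζ1 ?_) (norm_nonneg _)
      exact Nat.lt_succ_iff.1 (Finset.mem_range.1 hk)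
    have hnum : ‖gKer σ lam (lineL y) - ∑ k ∈ Finset.range (K + 1), p.coeff k * lineL y ^ k‖ ≤
        (2 ^ K * Real.exp (3 * lam) + S) * ‖lineL y‖ ^ K := by
      refine (norm_sub_le _ _).trans ?_
      have := hG.trans (mul_le_mul_of_nonneg_right hs (Real.exp_pos _).le)
      rw [mul_pow] at this
      nlinarith
    rw [div_le_div_iff₀ (by positivity) (by positivity)]
    calc ‖gKer σ lam (lineL y) - ∑ k ∈ Finset.range (K + 1), p.coeff k * lineL y ^ k‖ * ‖y‖
        ≤ (2 ^ K * Real.exp (3 * lam) + S) * ‖lineL y‖ ^ K * (4 * ‖lineL y‖) :=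
          mul_le_mul hnum (by linarith) (norm_nonneg _) (by positivity)
      _ = 4 * (2 ^ K * Real.exp (3 * lam) + S) * ‖lineL y‖ ^ (K + 1) := by rw [pow_succ]; ring
  -- Cauchy's integral formula in the chart
  have hyw : 0 < (yCoord w).im := by rw [yCoord_im]; linarith
  have hCauchy := Literature.Analysis.Complex.integral_div_sub_eq_of_upperHalfPlane hc hd hdecay hyw
  -- the value `h(y(w)) = H(w) = (G(w) − T(w))/w^{K+1}`
  have hval : h (yCoord w) = (gKer σ lam w - ∑ k ∈ Finset.range (K + 1), p.coeff k * w ^ k) / w ^ (K + 1) := by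
    rw [hh]; simp only; rw [lineL_yCoord, hHeq w hw0]
  -- the integrand on the real line
  set c : ℂ := (1 + I) / 2 with hc_def
  have hpt : ∀ x : ℝ, h x / (x - yCoord w) =
      gKer σ lam (lineL x) / ((lineL x) ^ (K + 1) * (lineL x - w)) * c -
        ∑ k ∈ Finset.range (K + 1), p.coeff k * ((lineL x) ^ k / ((lineL x) ^ (K + 1) * (lineL x - w)) * c) := by
    intro x
    have hz := lineL_ofReal_ne_zero x
    have hzw := lineL_ofReal_ne hw x
    have hzK : (lineL x) ^ (K + 1) ≠ 0 := pow_ne_zero _ hz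
    have h1I : (1:ℂ) + I ≠ 0 := by norm_num [Complex.ext_iff]
    have hc0 : c ≠ 0 := by rw [hc_def]; exact c_ne_zero
    have hxy : (x : ℂ) - yCoord w = (lineL x - w) / c := by
      rw [lineL_sub, hc_def]; field_simp
    have hsum : ∑ k ∈ Finset.range (K + 1), p.coeff k * ((lineL x) ^ k / ((lineL x) ^ (K + 1) * (lineL x - w)) * c)
        = (∑ k ∈ Finset.range (K + 1), p.coeff k * (lineL x) ^ k) * (c / ((lineL x) ^ (K + 1) * (lineL x - w))) := by
      rw [Finset.sum_mul]
      refine Finset.sum_congr rfl fun k _ ↦ ?_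
      ring
    rw [hsum, hh]
    simp only
    rw [hHeq _ hz, hxy]
    field_simp
  -- integrate
  have hiG := integrable_gKer_lineL_div hlam hK1 hKσ hw
  have hik : ∀ k ∈ Finset.range (K + 1),
      Integrable (fun x : ℝ ↦ p.coeff k * ((lineL x) ^ k / ((lineL x) ^ (K + 1) * (lineL x - w)) * c)) := by
    intro k hk
    exact ((integral_lineL_pow_div_eq_zero hw (Nat.lt_succ_iff.1 (Finset.mem_range.1 hk))).1).const_mul _
  have hsum : ∫ x : ℝ, h x / (x - yCoord w) =
      ∫ x : ℝ, gKer σ lam (lineL x) / ((lineL x) ^ (K + 1) * (lineL x - w)) * c := by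
    simp_rw [hpt]
    rw [integral_sub hiG (integrable_finsetSum _ hik), integral_finsetSum _ hik]
    have : ∑ k ∈ Finset.range (K + 1), ∫ x : ℝ, p.coeff k * ((lineL x) ^ k / ((lineL x) ^ (K + 1) * (lineL x - w)) * c) = 0 := by
      refine Finset.sum_eq_zero fun k hk ↦ ?_
      rw [MeasureTheory.integral_const_mul, (integral_lineL_pow_div_eq_zero hw (Nat.lt_succ_iff.1 (Finset.mem_range.1 hk))).2,
        mul_zero]
    rw [this, sub_zero]
  -- conclude
  rw [hsum, hval] at hCauchy
  have h2pi : (2 * π * I : ℂ) ≠ 0 := by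
    simp [Real.pi_ne_zero, Complex.I_ne_zero]
  have hwK : w ^ (K + 1) ≠ 0 := pow_ne_zero _ hw0
  simp_rw [hq]
  rw [lineRem, hCauchy]
  field_simp
  ring

/-- Integrability of `y ↦ |G(ζ(y))| |ζ(y)|^{−K−1}` along `L` (the majorant in (4.9)).
[cite: AriasDeReyna2011, proof of Thm. 4.2, eq. (4.9)] -/
lemma integrable_norm_gKer_lineL {σ lam : ℝ} (hlam : 0 ≤ lam) {K : ℕ} (hK1 : 1 ≤ K) (hKσ : 1 ≤ (K : ℝ) + σ) :
    Integrable (fun y : ℝ ↦ ((‖gKer σ lam (lineL y)‖ / ‖lineL y‖ ^ (K + 1) : ℝ) : ℂ)) := by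
  have hcont : Continuous fun y : ℝ ↦ ((‖gKer σ lam (lineL y)‖ / ‖lineL y‖ ^ (K + 1) : ℝ) : ℂ) := by
    have hl : Continuous fun y : ℝ ↦ lineL y := continuous_lineL.comp continuous_ofReal
    refine continuous_ofReal.comp (Continuous.div ?_ ((continuous_norm.comp hl).pow _)
      fun y ↦ pow_ne_zero _ (norm_ne_zero_iff.2 (lineL_ofReal_ne_zero y)))
    exact continuous_norm.comp ((continuousOn_gKer σ lam).comp_continuous hl
      fun y ↦ lineL_mem_cutPlane (by simp only [Complex.ofReal_im]; norm_num))
  refine Literature.Analysis.Complex.integrable_of_continuous_of_decay_sq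
    (C := 16 * (2 ^ (K - 1) * Real.exp (3 * lam))) (R := 8) hcont fun y hy ↦ ?_
  have hyc : ‖(y : ℂ)‖ = |y| := by simp
  have hy8 : 8 ≤ ‖(y : ℂ)‖ := by rw [hyc]; linarith
  have hL := norm_lineL_ge hy8
  rw [hyc] at hL
  have hζ2 : 2 ≤ ‖lineL y‖ := by linarith
  have hζ1 : 1 ≤ ‖lineL y‖ := by linarith
  have hζD : lineL (y : ℂ) ∈ cutPlane := lineL_mem_cutPlane (by simp only [Complex.ofReal_im]; norm_num)
  have hG := norm_gKer_le_far (σ := σ) hζD hζ2 hlam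
  have hs : (1 + ‖lineL y‖) ^ (max (-σ) 0) ≤ (2 * ‖lineL y‖) ^ (K - 1) := by
    have h1 : (1:ℝ) ≤ 1 + ‖lineL y‖ := by linarith [norm_nonneg (lineL (y:ℂ))]
    have hK' : max (-σ) 0 ≤ ((K - 1 : ℕ) : ℝ) := by
      have hK1' : (1:ℝ) ≤ K := by exact_mod_cast hK1
      rw [Nat.cast_sub hK1, Nat.cast_one]
      exact max_le (by linarith) (by linarith)
    calc (1 + ‖lineL y‖) ^ (max (-σ) 0) ≤ (1 + ‖lineL y‖) ^ (((K - 1 : ℕ) : ℝ)) :=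
          Real.rpow_le_rpow_of_exponent_le h1 hK'
      _ = (1 + ‖lineL y‖) ^ (K - 1) := Real.rpow_natCast _ _
      _ ≤ (2 * ‖lineL y‖) ^ (K - 1) := pow_le_pow_left₀ (by positivity) (by linarith) _
  rw [Complex.norm_real, Real.norm_eq_abs, abs_of_nonneg (by positivity)]
  have hypos : 0 < |y| := by linarith
  calc ‖gKer σ lam (lineL ↑y)‖ / ‖lineL ↑y‖ ^ (K + 1)
      ≤ (2 * ‖lineL y‖) ^ (K - 1) * Real.exp (3 * lam) / ‖lineL ↑y‖ ^ (K + 1) :=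
        div_le_div_of_nonneg_right (hG.trans (mul_le_mul_of_nonneg_right hs (Real.exp_pos _).le)) (by positivity)
    _ = 16 * (2 ^ (K - 1) * Real.exp (3 * lam)) / y ^ 2 * ((|y| / 4) / ‖lineL y‖) ^ 2 := by
        have hK : K + 1 = (K - 1) + 2 := by omega
        rw [hK, pow_add, mul_pow]
        have hz : ‖lineL (y:ℂ)‖ ≠ 0 := by positivity
        have hzK : ‖lineL (y:ℂ)‖ ^ (K - 1) ≠ 0 := pow_ne_zero _ hz
        have hyne : |y| ≠ 0 := hypos.ne'
        rw [← sq_abs y]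
        field_simp
        norm_num
    _ ≤ 16 * (2 ^ (K - 1) * Real.exp (3 * lam)) / y ^ 2 * 1 := by
        refine mul_le_mul_of_nonneg_left ?_ (by positivity)
        have : (|y| / 4) / ‖lineL ↑y‖ ≤ 1 := by rw [div_le_one (by positivity)]; exact hL
        calc ((|y| / 4) / ‖lineL ↑y‖) ^ 2 ≤ 1 ^ 2 := pow_le_pow_left₀ (by positivity) this 2
          _ = 1 := one_pow 2
    _ = 16 * (2 ^ (K - 1) * Real.exp (3 * lam)) / y ^ 2 := mul_one _

/-- **The bound for the line remainder** (first two lines of (4.9)): for `w` on the diagonal through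
`0`, `|(2πi)^{−1}∫_L G dζ/(ζ^{K+1}(ζ − w))| ≤ (1/π) ∫_ℝ |G(ζ(y))| |ζ(y)|^{−K−1} dy`
(`|dζ| = (√2/2) dy`, `|ζ − w| ≥ 1/(2√2)`). [cite: AriasDeReyna2011, proof of Thm. 4.2, eq. (4.9)] -/
theorem norm_lineRem_le {σ lam : ℝ} (hlam : 0 ≤ lam) {K : ℕ} (hK1 : 1 ≤ K) (hKσ : 1 ≤ (K : ℝ) + σ)
    {w : ℂ} (hw : w.re = w.im) :
    ‖lineRem σ lam K w‖ ≤ 1 / π * ∫ y : ℝ, ‖gKer σ lam (lineL y)‖ / ‖lineL y‖ ^ (K + 1) := by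
  have hw' : w.re - w.im < 1 / 2 := by rw [hw]; norm_num
  have hiG := integrable_gKer_lineL_div hlam hK1 hKσ hw'
  have hiB := integrable_norm_gKer_lineL hlam hK1 hKσ (σ := σ)
  have hiB' : Integrable (fun y : ℝ ↦ ‖gKer σ lam (lineL y)‖ / ‖lineL y‖ ^ (K + 1)) :=
    hiB.re.congr (Eventually.of_forall fun y ↦ by simp only [RCLike.re_to_complex, Complex.ofReal_re])
  -- pointwise: `‖F y‖ ≤ 2 ‖G‖/‖ζ‖^{K+1}`
  have hpt : ∀ y : ℝ, ‖gKer σ lam (lineL y) / ((lineL y) ^ (K + 1) * (lineL y - w)) * ((1 + I) / 2)‖ ≤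
      2 * (‖gKer σ lam (lineL y)‖ / ‖lineL y‖ ^ (K + 1)) := by
    intro y
    rw [norm_mul, norm_div, norm_mul, norm_pow]
    have h8 := normSq_lineL_sub_ge y hw
    have hcw : ‖(1 + I) / 2‖ / ‖lineL ↑y - w‖ ≤ 2 := by
      have hpos : 0 < ‖lineL ↑y - w‖ := norm_pos_iff.2 (lineL_ofReal_ne_of_diag y hw)
      rw [div_le_iff₀ hpos]
      have hc2 := normSq_c
      nlinarith [norm_nonneg ((1 + I) / 2), norm_nonneg (lineL ↑y - w)]
    have hζpos : 0 < ‖lineL ↑y‖ ^ (K + 1) := pow_pos (norm_pos_iff.2 (lineL_ofReal_ne_zero y)) _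
    have hζw : 0 < ‖lineL ↑y - w‖ := norm_pos_iff.2 (lineL_ofReal_ne_of_diag y hw)
    rw [div_mul_eq_mul_div, mul_comm, ← div_div, div_le_iff₀ hζw]
    calc ‖(1 + I) / 2‖ * ‖gKer σ lam (lineL ↑y)‖ / ‖lineL ↑y‖ ^ (K + 1)
        = (‖gKer σ lam (lineL ↑y)‖ / ‖lineL ↑y‖ ^ (K + 1)) * ‖(1 + I) / 2‖ := by ring
      _ ≤ (‖gKer σ lam (lineL ↑y)‖ / ‖lineL ↑y‖ ^ (K + 1)) * (2 * ‖lineL ↑y - w‖) :=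
          mul_le_mul_of_nonneg_left (by rwa [div_le_iff₀ hζw] at hcw) (by positivity)
      _ = 2 * (‖gKer σ lam (lineL ↑y)‖ / ‖lineL ↑y‖ ^ (K + 1)) * ‖lineL ↑y - w‖ := by ring
  rw [lineRem, norm_mul, norm_inv]
  have h2pi : ‖(2 * π * I : ℂ)‖ = 2 * π := by simp [Real.pi_pos.le]
  rw [h2pi]
  calc (2 * π)⁻¹ * ‖∫ y : ℝ, gKer σ lam (lineL y) / ((lineL y) ^ (K + 1) * (lineL y - w)) * ((1 + I) / 2)‖
      ≤ (2 * π)⁻¹ * ∫ y : ℝ, 2 * (‖gKer σ lam (lineL y)‖ / ‖lineL y‖ ^ (K + 1)) := by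
        refine mul_le_mul_of_nonneg_left ?_ (by positivity)
        exact (MeasureTheory.norm_integral_le_integral_norm _).trans (integral_mono hiG.norm (hiB'.const_mul 2) hpt)
    _ = 1 / π * ∫ y : ℝ, ‖gKer σ lam (lineL y)‖ / ‖lineL y‖ ^ (K + 1) := by
        rw [MeasureTheory.integral_const_mul]; ring

end AriasDeReyna

end Literature.NumberTheory.LFunctions
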